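import Summits.QuantumFields.YangMills.Theorems.BalabanUVNodesN15KingModelCurvatureStaggeredExact
import Summits.QuantumFields.YangMills.Theorems.BalabanUVNodesN15KingModelCurvatureBoundedBelow
import Summits.QuantumFields.YangMills.Theorems.BalabanUVNodesN15KingModelCurvatureDecay
import Summits.QuantumFields.YangMills.Theorems.BalabanUVNodesN15KingModelCurvatureTranslations
import HarnessLib

/-!
# BalabanUVNodes ∕ N15 — THE KING-MODEL RUNG (PART Ϳ-i): PART Ϳ «CURVATURE AS MASS» BY NAME — the package of PARTS Ϳ-a…Ϳ-h: plaquette coercivity at every unitary link field, the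
# constant-flux mass, π-flux and Kogut–Susskind exactness, the inhomogeneous and non-abelian curvature floors, curvature-induced exponential decay, magnetic translations; and the
# one-line contrast with the flat sector
# (Track A, DAG node N15 = NE2; FAN-OUT v1.1 §N15 s3 «KING-MODEL RUNG … + what the curved case adds»; count-neutral)

HONEST FRAMING.  Count-neutral (cell `pub-ymgap`, seat `pub-ymgap-dag-n15-e` g46; `--supports stmt-QuantumFields-27247 --as helper` = K3ᴬ, KEY MAP v3).  Conjunctions of theorems of
PARTS Ϳ-a…Ϳ-h BY NAME (nothing re-proved); King's fine covariance layer `−cΔ_U+m²` on ONE finite torus; NOT Bałaban's `G_k(U)`; NOT [Balaban1985BackgroundPropagators] (3.42); NOT a node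
discharge (N15 of record untouched); nothing continuum ∕ ℝ⁴ ∕ OS ∕ Clay.

* ★★★ `king_curvature_mass_package` — (1) Ϳ-b plaquette coercivity (any fibre, one orientation); (2) Ϳ-c the constant-flux mass `2c(2−2cos(p′∕4))`; (3) Ϳ-d π-flux: `min spec = m² + (4−2√2)c`
  exactly; (4) Ϳ-f the `U(1)` curvature floor `θ₀ ≤ |arg P|`; (5) Ϳ-g curvature-induced decay of the massless flux covariance; (6) Ϳ-h `|G_U(x+t,y+t)| = |G_U(x,y)|` under magnetic translations.
* ★★★ `king_ks_package` — Ϳ-e∕Ϳ-e′: all plaquettes `−1`, anticommutation, the exact band `[m²+(2(d+1)−2√(d+1))c, m²+(2(d+1)+2√(d+1))c]`.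
* ★★ `king_curvature_what_the_curved_case_adds` — THE CONTRAST IN ONE LINE: King's massless `c(−Δ) ⊗ 1` (`U ≡ 1`) is NOT positive definite (Ͱ-d), while at ANY non-zero constant flux the
  massless `−cΔ_U` IS (Ϳ-c) — curvature is an infrared regulator.
PRIOR TREE ART: PARTS Ϳ-a…Ϳ-h and Ͱ-d by name.  Dedup (rg at filing): basename 0 files; needles `king_curvature_mass_package|king_ks_package|king_curvature_what_the_curved_case_adds` 0 tree files.
Locators: [DodziukMathai2006] §1 Cor 1.3; [King1986] (2.12) p.653, (4.4) p.670; [Balaban1985BackgroundPropagators] (3.23) p.394; [tHooft1979Flux] NPB 153 (notion).  0 `sorry`, 0 `def`.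
-/

noncomputable section
open scoped BigOperators ComplexConjugate ComplexOrder InnerProductSpace
open Finset Matrix WithLp

namespace Summit.QuantumFields.YangMills.BalabanUVNodes.N15KingModelRung.Curvature

open Literature.MathematicalPhysics.QuantumFieldTheory.LatticeDiamagneticInequality (Hopping)
open Literature.MathematicalPhysics.QuantumFieldTheory.Balaban1983to89.B5Prop11Plancherel (Tor unitVec chi sOf)
open Literature.MathematicalPhysics.QuantumFieldTheory.King1986.Torus (tdistT)
open Summit.QuantumFields.YangMills.BalabanUVNodes.N15KingModelRung.Covariant (covLapF fib isHermitian_covLapF not_posDef_covLapF_massless_free)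
open Summit.QuantumFields.YangMills.BalabanUVNodes.N15KingModelRung.Cover (kingPlaq fluxLink)

variable {d : ℕ} (K : Fin (d + 1) → ℕ) [hK : ∀ μ, NeZero (K μ)]

/-- ★★★ **PART Ϳ «CURVATURE AS MASS» BY NAME** (`c ≥ 0` resp. `> 0` where stated; `ν₀ ≠ ν₁`): (1) plaquette coercivity at every unitary link field on any fibre (Ϳ-b); (2) the constant-flux
mass (Ϳ-c); (3) π-flux exactness (Ϳ-d, complex scalars, `K_{ν₀}` even); (4) the `U(1)` curvature floor (Ϳ-f); (5) exponential decay of the massless flux covariance (Ϳ-g); (6) translation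
invariance of its modulus under magnetic translations (Ϳ-h). [cite: DodziukMathai2006, Cor 1.3 §1; King1986, (2.12) p.653, (4.4) p.670; Balaban1985BackgroundPropagators, (3.23) p.394] -/
theorem king_curvature_mass_package {c : ℝ} (hc : 0 < c) {ν₀ ν₁ : Fin (d + 1)} (hν : ν₀ ≠ ν₁) :
    (∀ {n : Type} [Fintype n] [DecidableEq n] (m2 : ℝ) {U : Tor K × Fin (d + 1) → Matrix n n ℂ} (_hU : ∀ b, U b ∈ Matrix.unitaryGroup n ℂ) {γ : ℝ}
        (_hγ : ∀ x, ∀ u : EuclideanSpace ℂ n, RCLike.re ⟪u, Matrix.toEuclideanLin (kingPlaq K U x ν₀ ν₁) u⟫_ℂ ≤ γ * ‖u‖ ^ 2) (v : Tor K × n → ℂ),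
        (m2 + 2 * c * plaqGap γ) * ∑ x, ‖fib K v x‖ ^ 2 ≤ RCLike.re (star v ⬝ᵥ (covLapF K c m2 U *ᵥ v)))
    ∧ (∀ (m2 : ℝ) (p : Tor K) (v : Tor K × Unit → ℂ),
        (m2 + 2 * c * (2 - 2 * Real.cos (sOf K p ν₀ / 4))) * ∑ x, ‖fib K v x‖ ^ 2 ≤ (star v ⬝ᵥ (covLapF K c m2 (fluxLink K p ν₁) *ᵥ v)).re)
    ∧ (∀ (m2 : ℝ), Even (K ν₀) →
        (∀ i, m2 + (4 - 2 * Real.sqrt 2) * c ≤ (isHermitian_covLapF K c m2 (piFluxLink K (n := Unit) (𝕜 := ℂ) ν₀ ν₁)).eigenvalues i)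
          ∧ ∃ i, (isHermitian_covLapF K c m2 (piFluxLink K (n := Unit) (𝕜 := ℂ) ν₀ ν₁)).eigenvalues i = m2 + (4 - 2 * Real.sqrt 2) * c)
    ∧ (∀ (m2 : ℝ) {U : Tor K × Fin (d + 1) → Matrix Unit Unit ℂ} (_hU : ∀ b, U b ∈ Matrix.unitaryGroup Unit ℂ) {θ₀ : ℝ} (_h0 : 0 ≤ θ₀) (_hπ : θ₀ ≤ Real.pi)
        (_hθ : ∀ x, θ₀ ≤ |Complex.arg (kingPlaq K U x ν₀ ν₁ () ())|) (v : Tor K × Unit → ℂ),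
        (m2 + 2 * c * (2 - 2 * Real.cos (θ₀ / 4))) * ∑ x, ‖fib K v x‖ ^ 2 ≤ (star v ⬝ᵥ (covLapF K c m2 U *ᵥ v)).re)
    ∧ (∀ {p : Tor K}, p ν₀ ≠ 0 → ∃ δ : ℝ, 0 < δ ∧
        ∀ x y : Tor K, ‖(covLapF K c 0 (fluxLink K p ν₁))⁻¹ (x, ()) (y, ())‖ ≤ (c * (2 - 2 * Real.cos (sOf K p ν₀ / 4)))⁻¹ * Real.exp (-(δ * tdistT K x y)))
    ∧ (∀ (m2 : ℝ) {p t : Tor K}, chi K p t ^ K ν₁ = 1 → ∀ x y : Tor K,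
        ‖(covLapF K c m2 (fluxLink K p ν₁))⁻¹ (x + t, ()) (y + t, ())‖ = ‖(covLapF K c m2 (fluxLink K p ν₁))⁻¹ (x, ()) (y, ())‖) :=
  ⟨fun m2 _ hU _ hγ v => re_quadForm_covLapF_ge_plaq K hc.le m2 hU hν hγ v,
    fun m2 p v => re_quadForm_covLapF_fluxLink_ge K hc.le m2 p hν v,
    fun m2 hK2 => piFlux_spectral_bottom K hc.le m2 hK2 hν,
    fun m2 _ hU _ h0 hπ hθ v => re_quadForm_covLapF_ge_of_plaq_angle K hc.le m2 hU hν h0 hπ hθ v,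
    fun hp => by
      obtain ⟨δ, hδ, _, h⟩ := norm_covLapF_fluxLink_massless_inv_entry_le K hc hν hp
      exact ⟨δ, hδ, h⟩,
    fun m2 _ _ ht x y => norm_covLapF_fluxLink_inv_shift K c m2 ht x y⟩

/-- ★★★ **THE KOGUT–SUSSKIND SECTOR BY NAME** (all `K` even, `c ≥ 0`, non-trivial fibre): every plaquette is `−1`; the hoppings anticommute; the covariant kinetic band is EXACTLY
`[m² + (2(d+1)−2√(d+1))c, m² + (2(d+1)+2√(d+1))c]` (Ϳ-e∕Ϳ-e′). [cite: King1986, (2.12) p.653, (4.4) p.670; DodziukMathai2006, Cor 1.3 §1] -/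
theorem king_ks_package {𝕜 : Type*} [RCLike 𝕜] {n : Type*} [Fintype n] [DecidableEq n] [Nonempty n] {c : ℝ} (hc : 0 ≤ c) (m2 : ℝ) (hK2 : ∀ μ, Even (K μ)) :
    (∀ μ ν, μ ≠ ν → ∀ x, kingPlaq K (ksLink K (n := n) (𝕜 := 𝕜)) x μ ν = -1)
    ∧ (∀ μ ν, μ ≠ ν → ∀ v : Tor K × n → 𝕜, ksT K μ (ksT K ν v) = -ksT K ν (ksT K μ v))
    ∧ (∀ i, m2 + (2 * ((d : ℝ) + 1) - 2 * Real.sqrt ((d : ℝ) + 1)) * c ≤ (isHermitian_covLapF K c m2 (ksLink K (n := n) (𝕜 := 𝕜))).eigenvalues i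
        ∧ (isHermitian_covLapF K c m2 (ksLink K (n := n) (𝕜 := 𝕜))).eigenvalues i ≤ m2 + (2 * ((d : ℝ) + 1) + 2 * Real.sqrt ((d : ℝ) + 1)) * c)
    ∧ (∃ i, (isHermitian_covLapF K c m2 (ksLink K (n := n) (𝕜 := 𝕜))).eigenvalues i = m2 + (2 * ((d : ℝ) + 1) - 2 * Real.sqrt ((d : ℝ) + 1)) * c)
    ∧ (∃ i, (isHermitian_covLapF K c m2 (ksLink K (n := n) (𝕜 := 𝕜))).eigenvalues i = m2 + (2 * ((d : ℝ) + 1) + 2 * Real.sqrt ((d : ℝ) + 1)) * c) :=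
  ⟨fun _ _ hμν x => kingPlaq_ks K hK2 hμν x, fun _ _ hμν v => ksT_anticomm K hK2 hμν v, (ks_spectral_band_exact K hc m2 hK2).1, (ks_spectral_band_exact K hc m2 hK2).2.1,
    (ks_spectral_band_exact K hc m2 hK2).2.2⟩

/-- ★★ **WHAT THE CURVED CASE ADDS, IN ONE LINE**: King's own massless operator `c(−Δ) ⊗ 1` (`U ≡ 1`) is NOT positive definite (the constants are zero modes, Ͱ-d), while at every
NON-ZERO constant flux the massless covariant Laplacian IS positive definite (Ϳ-c) — curvature is an infrared regulator on every finite torus. [cite: DodziukMathai2006, Cor 1.3 §1; King1986, (4.4) p.670] -/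
theorem king_curvature_what_the_curved_case_adds {c : ℝ} (hc : 0 < c) {p : Tor K} {ν₀ ν₁ : Fin (d + 1)} (hν : ν₀ ≠ ν₁) (hp : p ν₀ ≠ 0) :
    ¬ (covLapF K c 0 (Hopping.free : Tor K × Fin (d + 1) → Matrix Unit Unit ℂ)).PosDef ∧ (covLapF K c 0 (fluxLink K p ν₁)).PosDef :=
  ⟨not_posDef_covLapF_massless_free K hc, posDef_covLapF_fluxLink_massless K hc hν hp⟩

end Summit.QuantumFields.YangMills.BalabanUVNodes.N15KingModelRung.Curvature

end
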